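import Mathlib.Analysis.SpecialFunctions.Gaussian.FourierTransform
import Mathlib.Analysis.Distribution.SchwartzSpace.Fourier
import Literature.Analysis.Fourier.BTWLowerBound
import Literature.NumberTheory.QuadraticForms.HilbertSymbolArchimedean
import HarnessLib

/-!
# Weil's index `γ(f)` of a second-degree character at the REAL place

Topic `NumberTheory/Weil1964`; namespace `Literature.NumberTheory.Weil1964`. KERNEL mathematics only
(two definitions with bodies + theorems; no named fact, no `axiom`, no `sorry`). Companion, at the
archimedean place `k = ℝ`, of `LocalQuadraticGaussIntegral.lean` (the non-archimedean Gauss integrals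
`g(f, M)` of [Weil1964, Chap. II n° 27]).

Let `G = ℝ` (self-dual through `⟨x, y⟩ = e^{2πi x y}`), and let `f` be the second-degree character
`f(x) = χ(q(x))` attached to the additive character `χ(x) = e^{2πi λ x}` (`λ ≠ 0`; [Weil1964, Chap. II n° 26
p. 173]: "le caractère `χ` sur `R` est nécessairement de la forme `χ(x) = e^{2πiλx}`") and the quadratic
form `q(x) = a x²`; only the product `c = λ a` matters and we write `f = realChirp c`,
`realChirp c x = e^{2πi c x²}`. Weil's THÉORÈME 2 ([Weil1964, Chap. I n° 14 p. 161]) says that a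
non-degenerate second-degree character `f` (associated with the symmetric morphism `ρ : G → G*`, here
`ρ = 2c` under the self-duality) "possède une transformée de Fourier" `γ(f) |ρ|^{-1/2} f̄(x* ρ⁻¹)`, where
`γ(f)` is a scalar of absolute value `1` — the **Weil index** of `f`; COROLLAIRE 2 (p. 162) reads
`∫ (Φ ∗ f) dx = γ(f) |ρ|^{-1/2} ∫ Φ dx` for `Φ ∈ 𝒮(G)`, and n° 26 (pp. 173–174) computes from it, "en prenant
par exemple `Φ(x) = e^{-πx²}`", the value `γ = e^{πi/4}` if `λ > 0` and `e^{-πi/4}` if `λ < 0` for `q(x) = x²`: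
"dans tous les cas, `γ(f)` est une racine huitième de l'unité".

This file DEFINES `realWeilIndex c = e^{iπ sgn(c)/4}` by that value and PROVES that it is the scalar of
Weil's Théorème 2 / Corollaire 2 for `f = realChirp c` (which determines it uniquely,
`realWeilIndex_unique`):

* §1 `realChirp`, its second-degree law, conjugation/equivalence rules, temperate growth (so that
  `Φ ↦ f · Φ` preserves `𝓢(ℝ)`, Mathlib `SchwartzMap.smulLeftCLM`);
* §2 `realWeilIndex` and its values: eighth root of unity (n° 26), `γ(-f) = conj γ(f)` and invariance under
  equivalent forms `c ↦ c b²` (n° 25), the quaternion-norm form `γ(q₄) = γ(q₁)⁴ = -1` (n° 26 / n° 28 Prop. 4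
  for `k = ℝ`), and n° 28's norm-residue formula `γ(q₁) γ(-a q₁) γ(-b q₁) γ(ab q₁) = (a, b)_ℝ` against the
  tree's Hilbert symbol `Literature.NumberTheory.QuadraticForms.hilbertSymbol ℝ`;
* §3 THÉORÈME 2 for `G = ℝ` in tested (tempered-distribution) form: for `g ∈ L¹(ℝ)` with `𝓕 g ∈ L¹(ℝ)`,
  `∫ e^{2πi d ξ²} 𝓕g(ξ) dξ = γ |2d|^{-1/2} ∫ e^{-2πi x²/(4d)} g(x) dx` (`integral_realChirp_mul_fourier`),
  proved from Mathlib's Fourier transform of the complex Gaussian `e^{-π(ε - 2id)ξ²}` (`fourier_gaussian_pi`)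
  and the self-adjointness of `𝓕` by dominated convergence as `ε → 0⁺` (both dominations are by `|𝓕 g|`,
  `|g|` since the regularised kernels have modulus `≤ 1`);
* §4 COROLLAIRE 2 for `G = ℝ` and every Schwartz `Φ` (`weil_corollary2_real`:
  `∫∫ Φ(u) f(x - u) du dx = γ(f) |2c|^{-1/2} ∫ Φ`), by `Φ ∗ f = f · 𝓕(f Φ)(2c ·)` and §3; uniqueness of `γ`.

Conventions. Mathlib's `𝓕 g(ξ) = ∫ e^{-2πi x ξ} g(x) dx`. The tree's standard character at a real place is
Tate's `ψ_ℝ(x) = e^{-2πi x}` (`λ = -1`, cf. `AdelicSecondDegreeCharacter.archSdChar`), for which the index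
of `q(x) = a x²` is `realWeilIndex (-a) = e^{-iπ sgn(a)/4}` (`realWeilIndex_neg`). The case `k = ℂ`
(`γ = 1`, n° 26) and the general `n`-variable form (n° 25 Prop. 3: `γ(f₁ ⊕ f₂) = γ(f₁) γ(f₂)`) are not
treated here. -- TODO(general form): `γ` of a non-degenerate quadratic form on `ℝⁿ` / on `ℂ`.

## References

* [Weil1964] A. Weil, *Sur certains groupes d'opérateurs unitaires*, Acta Math. 111 (1964) 143–211:
  Chap. I n° 14 Théorème 2, Corollaires 1–2 (pp. 161–162); Chap. II n° 25 (p. 173, incl. Prop. 3), n° 26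
  (pp. 173–174), n° 28 Prop. 4 and the last display of p. 176 with p. 177 l. 1 ("où `(a, b)` désigne le
  symbole de restes normiques"), formula (28) p. 177.
* O. T. O'Meara, *Introduction to quadratic forms* (1963), §63B (the Hilbert symbol over `ℝ`; tree file
  `QuadraticForms/HilbertSymbolArchimedean.lean`).
-/

set_option autoImplicit false

noncomputable section

open MeasureTheory Complex Filter Topology Set
open scoped Real FourierTransform SchwartzMap

namespace Literature.NumberTheory.Weil1964

/-! ## §1 The second-degree character `x ↦ e^{2πi c x²}` of `ℝ` -/

/-- The **second-degree character** `f(x) = χ(q(x)) = e^{2πi c x²}` of `G = ℝ` attached to the additive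
character `χ(x) = e^{2πiλx}` and the quadratic form `q(x) = a x²`, `c = λ a` (Weil's `χ ∘ f`; non-degenerate
iff `c ≠ 0`). [cite: Weil1964, Chap. II n° 26, p. 173] -/
def realChirp (c x : ℝ) : ℂ := cexp (2 * π * I * c * (x : ℂ) ^ 2)

/-- unfolding. [cite: Weil1964, Chap. II n° 26, p. 173] -/
theorem realChirp_apply (c x : ℝ) : realChirp c x = cexp (2 * π * I * c * (x : ℂ) ^ 2) := rfl

/-- `realChirp c x = 𝐞(c x²)` in terms of Mathlib's standard character `𝐞(t) = e^{2πi t}` of `ℝ` (Weil's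
`χ(x) = e^{2πiλx}` with `λ = 1`). [cite: Weil1964, Chap. II n° 26, p. 173] -/
theorem realChirp_eq_fourierChar (c x : ℝ) : realChirp c x = ((𝐞 (c * x ^ 2) : Circle) : ℂ) := by
  rw [realChirp, Real.fourierChar_apply]
  congr 1
  push_cast
  ring

/-- `|e^{2πi c x²}| = 1`: second-degree characters take values in `T`.
[cite: Weil1964, Chap. I n° 2, p. 146] -/
theorem norm_realChirp (c x : ℝ) : ‖realChirp c x‖ = 1 := by
  rw [realChirp_eq_fourierChar, Circle.norm_coe]

/-- `f(0) = 1`. [cite: Weil1964, Chap. I n° 2, p. 146] -/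
@[simp] theorem realChirp_zero_right (c : ℝ) : realChirp c 0 = 1 := by
  simp [realChirp]

/-- the degenerate form `c = 0` gives the trivial character. [cite: Weil1964, Chap. I n° 2, p. 146] -/
@[simp] theorem realChirp_zero_left (x : ℝ) : realChirp 0 x = 1 := by
  simp [realChirp]

/-- **the second-degree law** `f(x + y) = f(x) f(y) e^{2πi (2c x) y}`: `f` is a character of the second
degree whose associated bicharacter is `⟨x ρ, y⟩` with `ρ = 2c`. [cite: Weil1964, Chap. I n° 2, p. 146] -/
theorem realChirp_add (c x y : ℝ) :
    realChirp c (x + y) = realChirp c x * realChirp c y * cexp (2 * π * I * (2 * c * x * y : ℝ)) := by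
  simp only [realChirp, ← Complex.exp_add]
  congr 1
  push_cast
  ring

/-- the second-degree law in the form used for convolutions:
`f(x - u) = f(x) f(u) e^{-2πi u (2 c x)}` (the last factor is Mathlib's Fourier kernel at the frequency
`2 c x`). [cite: Weil1964, Chap. I n° 2, p. 146] -/
theorem realChirp_sub (c x u : ℝ) :
    realChirp c (x - u) = realChirp c x * realChirp c u * cexp (↑(-2 * π * u * (2 * c * x)) * I) := by
  simp only [realChirp, ← Complex.exp_add]
  congr 1
  push_cast
  ring

/-- `χ ∘ (-f)` is the complex conjugate of `χ ∘ f`. [cite: Weil1964, Chap. II n° 25, p. 173] -/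
theorem realChirp_neg_left (c x : ℝ) : realChirp (-c) x = (starRingEnd ℂ) (realChirp c x) := by
  rw [realChirp, realChirp, ← Complex.exp_conj]
  congr 1
  simp only [map_mul, map_pow, Complex.conj_ofReal, Complex.conj_I, map_ofNat]
  push_cast
  ring

/-- `f(x) · (χ ∘ (-f))(x) = 1`. [cite: Weil1964, Chap. II n° 25, p. 173] -/
theorem realChirp_mul_realChirp_neg (c x : ℝ) : realChirp c x * realChirp (-c) x = 1 := by
  rw [realChirp, realChirp, ← Complex.exp_add, ← Complex.exp_zero]
  congr 1
  push_cast
  ring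

/-- equivalent forms: `e^{2πi (c b²) x²} = e^{2πi c (b x)²}` (`q` and `q ∘ (x ↦ b x)` are "équivalentes").
[cite: Weil1964, Chap. II n° 25, p. 173] -/
theorem realChirp_mul_sq (c b x : ℝ) : realChirp (c * b ^ 2) x = realChirp c (b * x) := by
  simp only [realChirp]
  congr 1
  push_cast
  ring

/-- `f` is continuous. [cite: Weil1964, Chap. I n° 2, p. 146] -/
@[fun_prop]
theorem continuous_realChirp (c : ℝ) : Continuous (realChirp c) := by
  unfold realChirp
  fun_prop

/-- **`f = e^{2πi c x²}` has temperate growth** (its derivatives are polynomials times `f`), so that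
multiplication by `f` is a continuous endomorphism of `𝓢(ℝ)` — Weil's `t(f)` restricted to `𝒮(G)`
([Weil1964, Chap. I n° 12 Prop. 2]). [cite: Weil1964, Chap. I n° 12, p. 158] -/
theorem hasTemperateGrowth_realChirp (c : ℝ) : (realChirp c).HasTemperateGrowth := by
  have hq : (fun x : ℝ => 2 * π * c * x ^ 2).HasTemperateGrowth :=
    (Function.HasTemperateGrowth.const (2 * π * c)).mul (Function.HasTemperateGrowth.id'.pow 2)
  -- `s ↦ e^{is}` has temperate growth: the tree's `Literature.Analysis.Fourier.hasTemperateGrowth_exp_I_mul`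
  have h := Literature.Analysis.Fourier.hasTemperateGrowth_exp_I_mul.comp hq
  convert h using 1
  funext x
  simp only [Function.comp_apply, realChirp]
  congr 1
  push_cast
  ring

/-! ## §2 The Weil index at the real place: definition by its value and elementary identities -/

/-- **Weil's index `γ(f)` of the second-degree character `f = e^{2πi c x²}` of `ℝ`**: the scalar of absolute
value `1` in Weil's Théorème 2 / Corollaire 2 (`integral_realChirp_mul_fourier`, `weil_corollary2_real`,
which determine it: `realWeilIndex_unique`), DEFINED here by its value `e^{iπ sgn(c)/4}` computed in n° 26
("`e^{πi/4}` si `λ > 0` et `e^{-πi/4}` si `λ < 0`" for `q(x) = x²`; junk value `1` for the degenerate `c = 0`).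
[cite: Weil1964, Chap. I n° 14 Thm 2 p. 161; Chap. II n° 26 pp. 173–174] -/
def realWeilIndex (c : ℝ) : ℂ := cexp (((π / 4 * (SignType.sign c : ℝ) : ℝ) : ℂ) * I)

/-- unfolding. [cite: Weil1964, Chap. II n° 26, p. 174] -/
theorem realWeilIndex_apply (c : ℝ) :
    realWeilIndex c = cexp (((π / 4 * (SignType.sign c : ℝ) : ℝ) : ℂ) * I) := rfl

/-- `γ = e^{πi/4}` for `λ a > 0`. [cite: Weil1964, Chap. II n° 26, p. 174] -/
theorem realWeilIndex_of_pos {c : ℝ} (hc : 0 < c) : realWeilIndex c = cexp (π / 4 * I) := by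
  rw [realWeilIndex, sign_pos hc, SignType.coe_one]
  congr 1
  push_cast
  ring

/-- `γ = e^{-πi/4}` for `λ a < 0`. [cite: Weil1964, Chap. II n° 26, p. 174] -/
theorem realWeilIndex_of_neg {c : ℝ} (hc : c < 0) : realWeilIndex c = cexp (-(π / 4 * I)) := by
  rw [realWeilIndex, sign_neg hc, SignType.coe_neg_one]
  congr 1
  push_cast
  ring

/-- junk value at the degenerate form. [folklore] -/
@[simp] private theorem realWeilIndex_zero : realWeilIndex 0 = 1 := by
  simp [realWeilIndex]

/-- `γ(q₁) = e^{πi/4}` for Weil's `q₁(x) = x²` and `χ(x) = e^{2πix}`. [cite: Weil1964, Chap. II n° 26, p. 174] -/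
theorem realWeilIndex_one : realWeilIndex 1 = cexp (π / 4 * I) := realWeilIndex_of_pos one_pos

/-- `|γ(f)| = 1`. [cite: Weil1964, Chap. I n° 14 Thm 2, p. 161] -/
theorem norm_realWeilIndex (c : ℝ) : ‖realWeilIndex c‖ = 1 := by
  rw [realWeilIndex, Complex.norm_exp_ofReal_mul_I]

/-- `γ(f) ≠ 0`. [cite: Weil1964, Chap. I n° 14 Thm 2, p. 161] -/
theorem realWeilIndex_ne_zero (c : ℝ) : realWeilIndex c ≠ 0 := Complex.exp_ne_zero _

/-- `e^{πi/4} e^{πi/4} = i`. [folklore] -/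
private theorem cexp_pi_div_four_mul_I_mul_self : cexp (π / 4 * I) * cexp (π / 4 * I) = I := by
  rw [← Complex.exp_add, show (π : ℂ) / 4 * I + π / 4 * I = (↑(π / 2) : ℂ) * I by push_cast; ring,
    Complex.exp_mul_I, ← Complex.ofReal_cos, ← Complex.ofReal_sin, Real.cos_pi_div_two,
    Real.sin_pi_div_two]
  simp

/-- `e^{πi/4} e^{-πi/4} = 1`. [folklore] -/
private theorem cexp_pi_div_four_mul_I_mul_cexp_neg : cexp (π / 4 * I) * cexp (-(π / 4 * I)) = 1 := by
  rw [← Complex.exp_add, add_neg_cancel, Complex.exp_zero]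

/-- **"dans tous les cas, `γ(f)` est une racine huitième de l'unité."** [cite: Weil1964, Chap. II n° 26, p. 174] -/
theorem realWeilIndex_pow_eight (c : ℝ) : realWeilIndex c ^ 8 = 1 := by
  rcases lt_trichotomy c 0 with hc | rfl | hc
  · rw [realWeilIndex_of_neg hc, ← Complex.exp_nat_mul,
      show ((8 : ℕ) : ℂ) * -(π / 4 * I) = -(2 * π * I) by push_cast; ring, Complex.exp_neg,
      Complex.exp_two_pi_mul_I, inv_one]
  · simp
  · rw [realWeilIndex_of_pos hc, ← Complex.exp_nat_mul,
      show ((8 : ℕ) : ℂ) * (π / 4 * I) = 2 * π * I by push_cast; ring, Complex.exp_two_pi_mul_I]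

/-- **`γ(-f) = γ(f)⁻¹ = conj γ(f)`** ("comme `χ∘(-f)` est l'imaginaire conjugué de `χ∘f`, on a
`γ(-f) = γ(f)⁻¹`"). [cite: Weil1964, Chap. II n° 25, p. 173] -/
theorem realWeilIndex_neg (c : ℝ) : realWeilIndex (-c) = (starRingEnd ℂ) (realWeilIndex c) := by
  rw [realWeilIndex, realWeilIndex, ← Complex.exp_conj, Left.sign_neg, SignType.coe_neg]
  congr 1
  simp only [map_mul, Complex.conj_ofReal, Complex.conj_I]
  push_cast
  ring

/-- `γ(-f) = γ(f)⁻¹`. [cite: Weil1964, Chap. II n° 25, p. 173] -/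
theorem realWeilIndex_neg_eq_inv (c : ℝ) : realWeilIndex (-c) = (realWeilIndex c)⁻¹ := by
  rw [realWeilIndex_neg]
  exact (Complex.inv_eq_conj (norm_realWeilIndex c)).symm

/-- `γ(f) γ(-f) = 1`. [cite: Weil1964, Chap. II n° 25, p. 173] -/
theorem realWeilIndex_mul_realWeilIndex_neg (c : ℝ) : realWeilIndex c * realWeilIndex (-c) = 1 := by
  rw [realWeilIndex_neg_eq_inv, mul_inv_cancel₀ (realWeilIndex_ne_zero c)]

/-- **equivalent forms have the same index**: `γ` of `c x²` only depends on `c` up to positive factors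
(`q ∘ (x ↦ b x) = (c b²) x²`: "`γ` a même valeur pour deux formes équivalentes").
[cite: Weil1964, Chap. II n° 25, p. 173] -/
theorem realWeilIndex_mul_of_pos {c r : ℝ} (hr : 0 < r) : realWeilIndex (c * r) = realWeilIndex c := by
  rw [realWeilIndex, realWeilIndex, sign_mul, sign_pos hr, mul_one]

/-- equivalent forms, stated with a square: `γ(c b² x²) = γ(c x²)` for `b ≠ 0`.
[cite: Weil1964, Chap. II n° 25, p. 173] -/
theorem realWeilIndex_mul_sq {c b : ℝ} (hb : b ≠ 0) : realWeilIndex (c * b ^ 2) = realWeilIndex c :=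
  realWeilIndex_mul_of_pos (by positivity)

/-- in particular `γ` for `c` and for `1/(4c)` (the parameter of the Fourier-transformed character,
`f̄(x* ρ⁻¹)` with `ρ = 2c`) coincide. [cite: Weil1964, Chap. I n° 14 Thm 2, p. 161] -/
theorem realWeilIndex_one_div_four_mul (c : ℝ) : realWeilIndex (1 / (4 * c)) = realWeilIndex c := by
  rcases eq_or_ne c 0 with rfl | hc
  · simp
  · rw [show 1 / (4 * c) = c * (1 / (2 * c)) ^ 2 by field_simp; ring]
    exact realWeilIndex_mul_sq (by positivity)

/-- **Weil's `γ(q₄) = -1` at the real place**: for the norm form `q₄ = x₁² + x₂² + x₃² + x₄²` of Hamilton's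
quaternions (inertia `(4, 0)`, so `γ(q₄) = γ(q₁)⁴` by n° 25 Prop. 3) one has `γ(q₁)⁴ = e^{±iπ} = -1`
("On notera qu'on a toujours aussi `γ(q₄) = -1`"; n° 28 Prop. 4 "valable aussi pour `k = R`").
[cite: Weil1964, Chap. II n° 26 p. 174 and n° 28 Prop. 4 p. 176] -/
theorem realWeilIndex_pow_four {c : ℝ} (hc : c ≠ 0) : realWeilIndex c ^ 4 = -1 := by
  rcases lt_or_gt_of_ne hc with hc | hc
  · rw [realWeilIndex_of_neg hc, ← Complex.exp_nat_mul,
      show ((4 : ℕ) : ℂ) * -(π / 4 * I) = -(π * I) by push_cast; ring, Complex.exp_neg,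
      Complex.exp_pi_mul_I]
    norm_num
  · rw [realWeilIndex_of_pos hc, ← Complex.exp_nat_mul,
      show ((4 : ℕ) : ℂ) * (π / 4 * I) = π * I by push_cast; ring, Complex.exp_pi_mul_I]

/-- `γ(c x²)² = sgn(c) · i`. [cite: Weil1964, Chap. II n° 26, p. 174] -/
theorem realWeilIndex_sq {c : ℝ} (hc : c ≠ 0) : realWeilIndex c ^ 2 = (SignType.sign c : ℝ) * I := by
  rcases lt_or_gt_of_ne hc with hc | hc
  · rw [realWeilIndex_of_neg hc, sign_neg hc, SignType.coe_neg_one, sq]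
    have h : cexp (-(π / 4 * I)) * cexp (-(π / 4 * I)) * I = 1 := by
      calc cexp (-(π / 4 * I)) * cexp (-(π / 4 * I)) * I
          = cexp (-(π / 4 * I)) * cexp (-(π / 4 * I)) * (cexp (π / 4 * I) * cexp (π / 4 * I)) := by
            rw [cexp_pi_div_four_mul_I_mul_self]
        _ = (cexp (π / 4 * I) * cexp (-(π / 4 * I))) * (cexp (π / 4 * I) * cexp (-(π / 4 * I))) := by
            ring
        _ = 1 := by rw [cexp_pi_div_four_mul_I_mul_cexp_neg, one_mul]
    -- `z * I = 1 ⇒ z = -I`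
    have h' : cexp (-(π / 4 * I)) * cexp (-(π / 4 * I)) = -I := by
      have := congr_arg (· * (-I)) h
      simpa [mul_assoc] using this
    rw [h']
    push_cast
    ring
  · rw [realWeilIndex_of_pos hc, sign_pos hc, SignType.coe_one, sq, cexp_pi_div_four_mul_I_mul_self]
    push_cast
    ring

/-- **Weil's formula `γ(a q₁)² = (a, -1) γ(q₁)²` at the real place** (the Hilbert symbol `(a, -1)_ℝ` is `sgn a`).
[cite: Weil1964, Chap. II n° 28, p. 177 (line before (28))] -/
theorem realWeilIndex_mul_sq_eq {c a : ℝ} (hc : c ≠ 0) (ha : a ≠ 0) :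
    realWeilIndex (a * c) ^ 2 = (QuadraticForms.hilbertSymbol ℝ a (-1) : ℂ) * realWeilIndex c ^ 2 := by
  rw [realWeilIndex_sq (mul_ne_zero ha hc), realWeilIndex_sq hc, sign_mul, SignType.coe_mul]
  rcases lt_or_gt_of_ne ha with ha | ha
  · have h1 : QuadraticForms.hilbertSymbol ℝ a (-1) = -1 :=
      (QuadraticForms.Real.hilbertSymbol_eq_neg_one_iff a (-1)).2 ⟨ha.le, by norm_num⟩
    rw [h1, sign_neg ha, SignType.coe_neg_one]
    push_cast
    ring
  · have h1 : QuadraticForms.hilbertSymbol ℝ a (-1) = 1 :=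
      (QuadraticForms.Real.hilbertSymbol_eq_one_iff a (-1)).2 (Or.inl ha)
    rw [h1, sign_pos ha, SignType.coe_one]
    push_cast
    ring

/-- Weil's norm-residue formula for a POSITIVE character parameter `l`. [cite: Weil1964, Chap. II n° 28, pp. 176–177] -/
private theorem realWeilIndex_hilbertSymbol_of_pos {l a b : ℝ} (hl : 0 < l) (ha : a ≠ 0) (hb : b ≠ 0) :
    realWeilIndex l * realWeilIndex (-(l * a)) * realWeilIndex (-(l * b)) * realWeilIndex (l * (a * b)) =
      (QuadraticForms.hilbertSymbol ℝ a b : ℂ) := by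
  rw [show -(l * a) = (-a) * l by ring, show -(l * b) = (-b) * l by ring,
    show l * (a * b) = (a * b) * l by ring, realWeilIndex_mul_of_pos hl, realWeilIndex_mul_of_pos hl,
    realWeilIndex_mul_of_pos hl, realWeilIndex_of_pos hl]
  have hγ2 := cexp_pi_div_four_mul_I_mul_self
  have hγγ' := cexp_pi_div_four_mul_I_mul_cexp_neg
  rcases lt_or_gt_of_ne ha with ha' | ha' <;> rcases lt_or_gt_of_ne hb with hb' | hb'
  · -- `a < 0`, `b < 0`: `(a, b) = -1`
    have h1 : QuadraticForms.hilbertSymbol ℝ a b = -1 :=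
      (QuadraticForms.Real.hilbertSymbol_eq_neg_one_iff a b).2 ⟨ha'.le, hb'.le⟩
    rw [h1, realWeilIndex_of_pos (neg_pos.2 ha'), realWeilIndex_of_pos (neg_pos.2 hb'),
      realWeilIndex_of_pos (mul_pos_of_neg_of_neg ha' hb')]
    calc cexp (π / 4 * I) * cexp (π / 4 * I) * cexp (π / 4 * I) * cexp (π / 4 * I)
        = (cexp (π / 4 * I) * cexp (π / 4 * I)) * (cexp (π / 4 * I) * cexp (π / 4 * I)) := by ring
      _ = _ := by rw [hγ2, Complex.I_mul_I]; push_cast; ring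
  · -- `a < 0 < b`: `(a, b) = 1`
    have h1 : QuadraticForms.hilbertSymbol ℝ a b = 1 :=
      (QuadraticForms.Real.hilbertSymbol_eq_one_iff a b).2 (Or.inr hb')
    rw [h1, realWeilIndex_of_pos (neg_pos.2 ha'), realWeilIndex_of_neg (neg_neg_of_pos hb'),
      realWeilIndex_of_neg (mul_neg_of_neg_of_pos ha' hb')]
    calc cexp (π / 4 * I) * cexp (π / 4 * I) * cexp (-(π / 4 * I)) * cexp (-(π / 4 * I))
        = (cexp (π / 4 * I) * cexp (-(π / 4 * I))) * (cexp (π / 4 * I) * cexp (-(π / 4 * I))) := by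
          ring
      _ = _ := by rw [hγγ']; push_cast; ring
  · -- `b < 0 < a`: `(a, b) = 1`
    have h1 : QuadraticForms.hilbertSymbol ℝ a b = 1 :=
      (QuadraticForms.Real.hilbertSymbol_eq_one_iff a b).2 (Or.inl ha')
    rw [h1, realWeilIndex_of_neg (neg_neg_of_pos ha'), realWeilIndex_of_pos (neg_pos.2 hb'),
      realWeilIndex_of_neg (mul_neg_of_pos_of_neg ha' hb')]
    calc cexp (π / 4 * I) * cexp (-(π / 4 * I)) * cexp (π / 4 * I) * cexp (-(π / 4 * I))
        = (cexp (π / 4 * I) * cexp (-(π / 4 * I))) * (cexp (π / 4 * I) * cexp (-(π / 4 * I))) := by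
          ring
      _ = _ := by rw [hγγ']; push_cast; ring
  · -- `a, b > 0`: `(a, b) = 1`
    have h1 : QuadraticForms.hilbertSymbol ℝ a b = 1 :=
      (QuadraticForms.Real.hilbertSymbol_eq_one_iff a b).2 (Or.inl ha')
    rw [h1, realWeilIndex_of_neg (neg_neg_of_pos ha'), realWeilIndex_of_neg (neg_neg_of_pos hb'),
      realWeilIndex_of_pos (mul_pos ha' hb')]
    calc cexp (π / 4 * I) * cexp (-(π / 4 * I)) * cexp (-(π / 4 * I)) * cexp (π / 4 * I)
        = (cexp (π / 4 * I) * cexp (-(π / 4 * I))) * (cexp (π / 4 * I) * cexp (-(π / 4 * I))) := by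
          ring
      _ = _ := by rw [hγγ']; push_cast; ring

/-- **Weil's norm-residue formula at the real place**: for `λ a b ≠ 0`,
`γ(q₁) γ(-a q₁) γ(-b q₁) γ(ab q₁) = (a, b)_ℝ`, i.e. (by n° 25 Prop. 3, `γ` being multiplicative on orthogonal
sums) `γ(x² - a y² - b z² + ab t²) = (a, b)`, "où `(a, b)` désigne le symbole de restes normiques" — here the
tree's `hilbertSymbol ℝ a b` (`= -1` iff `a, b < 0`). Stated for the character `e^{2πiλx}`, any `λ ≠ 0`.
[cite: Weil1964, Chap. II n° 28, p. 176 (last display) – p. 177 l. 1] -/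
theorem realWeilIndex_hilbertSymbol {l a b : ℝ} (hl : l ≠ 0) (ha : a ≠ 0) (hb : b ≠ 0) :
    realWeilIndex l * realWeilIndex (-(l * a)) * realWeilIndex (-(l * b)) * realWeilIndex (l * (a * b)) =
      (QuadraticForms.hilbertSymbol ℝ a b : ℂ) := by
  rcases lt_or_gt_of_ne hl with hl' | hl'
  · -- `l < 0`: conjugate the formula for `-l > 0` (`γ(-f) = conj γ(f)`, the right-hand side is real)
    have key := congr_arg (starRingEnd ℂ) (realWeilIndex_hilbertSymbol_of_pos (neg_pos.2 hl') ha hb)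
    rw [map_mul, map_mul, map_mul, ← realWeilIndex_neg, ← realWeilIndex_neg, ← realWeilIndex_neg,
      ← realWeilIndex_neg, map_intCast] at key
    simp only [neg_mul, neg_neg] at key
    exact key
  · exact realWeilIndex_hilbertSymbol_of_pos hl' ha hb

/-- the same formula in the normalised shape used for metaplectic cocycles:
`γ(c) γ(ab c) = (a, b)_ℝ γ(a c) γ(b c)`. [cite: Weil1964, Chap. II n° 28, pp. 176–177] -/
theorem realWeilIndex_mul_mul {c a b : ℝ} (hc : c ≠ 0) (ha : a ≠ 0) (hb : b ≠ 0) :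
    realWeilIndex c * realWeilIndex (a * b * c) =
      (QuadraticForms.hilbertSymbol ℝ a b : ℂ) * (realWeilIndex (a * c) * realWeilIndex (b * c)) := by
  have key := realWeilIndex_hilbertSymbol hc ha hb
  have h1 : realWeilIndex (-(c * a)) * realWeilIndex (a * c) = 1 := by
    rw [mul_comm (realWeilIndex _), show -(c * a) = -(a * c) by ring]
    exact realWeilIndex_mul_realWeilIndex_neg _
  have h2 : realWeilIndex (-(c * b)) * realWeilIndex (b * c) = 1 := by
    rw [mul_comm (realWeilIndex _), show -(c * b) = -(b * c) by ring]
    exact realWeilIndex_mul_realWeilIndex_neg _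
  calc realWeilIndex c * realWeilIndex (a * b * c)
      = realWeilIndex c * realWeilIndex (c * (a * b)) * (realWeilIndex (-(c * a)) * realWeilIndex (a * c)) *
          (realWeilIndex (-(c * b)) * realWeilIndex (b * c)) := by
        rw [h1, h2, mul_one, mul_one, show a * b * c = c * (a * b) by ring]
    _ = (realWeilIndex c * realWeilIndex (-(c * a)) * realWeilIndex (-(c * b)) *
          realWeilIndex (c * (a * b))) * (realWeilIndex (a * c) * realWeilIndex (b * c)) := by ring
    _ = _ := by rw [key]

/-! ## §3 Théorème 2 for `G = ℝ`: the Fourier transform of `f` as a tempered distribution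

Weil's `γ(f) |ρ|^{-1/2} f̄(x* ρ⁻¹)` "est la transformée de Fourier de `f`" is proved in the tested form
`∫ f · 𝓕g = ∫ 𝓕(f) · g` for `g, 𝓕g ∈ L¹`, with `𝓕(f)(ξ) = γ(f) |2d|^{-1/2} e^{-2πi ξ²/(4d)}`, by regularisation:
for `ε > 0` the character `e^{-πεξ²} f(ξ) = e^{-π b_ε ξ²}`, `b_ε = ε - 2id`, is an integrable Gaussian whose
Fourier transform Mathlib knows (`b_ε^{-1/2} e^{-π x²/b_ε}`), and `ε → 0⁺` is dominated convergence on both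
sides. -/

/-- the Gaussian parameter `b_ε = ε - 2id` of the regularised character
`e^{-πεξ²} e^{2πi d ξ²} = e^{-π b_ε ξ²}`. [folklore] -/
private def bReg (d ε : ℝ) : ℂ := (ε : ℂ) - 2 * d * I

/-- `Re b_ε = ε`. [folklore] -/
private theorem bReg_re (d ε : ℝ) : (bReg d ε).re = ε := by
  simp [bReg]

/-- `Im b_ε = -2d`. [folklore] -/
private theorem bReg_im (d ε : ℝ) : (bReg d ε).im = -(2 * d) := by
  simp [bReg]

/-- `b_0 = -2id`. [folklore] -/
private theorem bReg_zero (d : ℝ) : bReg d 0 = -2 * d * I := by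
  simp [bReg]

/-- `ε ↦ b_ε` is continuous. [folklore] -/
private theorem continuous_bReg (d : ℝ) : Continuous (bReg d) := by
  unfold bReg
  fun_prop

/-- `b_ε ≠ 0` (`d ≠ 0`). [folklore] -/
private theorem bReg_ne_zero {d : ℝ} (hd : d ≠ 0) (ε : ℝ) : bReg d ε ≠ 0 := by
  intro h
  have := congr_arg Complex.im h
  rw [bReg_im, Complex.zero_im, neg_eq_zero] at this
  exact hd (by linarith)

/-- `|2d| ≤ |b_ε|`. [folklore] -/
private theorem abs_le_norm_bReg (d ε : ℝ) : |2 * d| ≤ ‖bReg d ε‖ := by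
  have h := Complex.abs_im_le_norm (bReg d ε)
  rwa [bReg_im, abs_neg] at h

/-- the regularised characters have modulus `≤ 1` (`ε ≥ 0`). [folklore] -/
private theorem norm_cexp_bReg_le (d : ℝ) {ε : ℝ} (hε : 0 ≤ ε) (ξ : ℝ) :
    ‖cexp (-π * bReg d ε * (ξ : ℂ) ^ 2)‖ ≤ 1 := by
  rw [Complex.norm_exp, Real.exp_le_one_iff,
    show -π * bReg d ε * (ξ : ℂ) ^ 2 = ((-(π * ξ ^ 2) : ℝ) : ℂ) * bReg d ε by push_cast; ring,
    Complex.re_ofReal_mul, bReg_re]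
  have : 0 ≤ π * ξ ^ 2 * ε := by positivity
  linarith

/-- the Fourier-side kernels `e^{-π x²/b_ε}` have modulus `≤ 1` (`ε ≥ 0`). [folklore] -/
private theorem norm_cexp_div_bReg_le (d : ℝ) {ε : ℝ} (hε : 0 ≤ ε) (x : ℝ) :
    ‖cexp (-π / bReg d ε * (x : ℂ) ^ 2)‖ ≤ 1 := by
  rw [Complex.norm_exp, Real.exp_le_one_iff,
    show -π / bReg d ε * (x : ℂ) ^ 2 = ((-(π * x ^ 2) : ℝ) : ℂ) * (bReg d ε)⁻¹ by
      rw [div_eq_mul_inv]; push_cast; ring,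
    Complex.re_ofReal_mul, Complex.inv_re, bReg_re]
  have h1 : 0 ≤ ε / Complex.normSq (bReg d ε) := div_nonneg hε (Complex.normSq_nonneg _)
  have : 0 ≤ π * x ^ 2 * (ε / Complex.normSq (bReg d ε)) := by positivity
  linarith

/-- `|b_ε^{-1/2}| ≤ |2d|^{-1/2}`. [folklore] -/
private theorem norm_one_div_cpow_bReg_le {d : ℝ} (hd : d ≠ 0) (ε : ℝ) :
    ‖1 / bReg d ε ^ (1 / 2 : ℂ)‖ ≤ |2 * d| ^ (-(1 / 2 : ℝ)) := by
  have hpos : 0 < |2 * d| := abs_pos.2 (mul_ne_zero two_ne_zero hd)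
  rw [norm_div, norm_one, show (1 / 2 : ℂ) = ((1 / 2 : ℝ) : ℂ) by push_cast; ring,
    Complex.norm_cpow_real, Real.rpow_neg hpos.le, ← one_div]
  exact one_div_le_one_div_of_le (Real.rpow_pos_of_pos hpos _)
    (Real.rpow_le_rpow hpos.le (abs_le_norm_bReg d ε) (by norm_num))

/-- `(-2id)^{1/2} = √|2d| · e^{-iπ sgn(d)/4}` (principal branch; n° 26's "calcul élémentaire"). [folklore] -/
private theorem cpow_half_neg_two_mul_I {d : ℝ} (hd : d ≠ 0) :
    (-2 * (d : ℂ) * I) ^ (1 / 2 : ℂ) =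
      (Real.sqrt |2 * d| : ℂ) * cexp (((-(π / 4 * (SignType.sign d : ℝ)) : ℝ) : ℂ) * I) := by
  set θ : ℝ := -(π / 4 * (SignType.sign d : ℝ)) with hθ
  set w : ℂ := (Real.sqrt |2 * d| : ℂ) * cexp ((θ : ℂ) * I) with hw
  have h2d : 0 < |2 * d| := abs_pos.2 (mul_ne_zero two_ne_zero hd)
  have hr : 0 < Real.sqrt |2 * d| := Real.sqrt_pos.2 h2d
  have hθval : θ = π / 4 ∨ θ = -(π / 4) := by
    rcases lt_or_gt_of_ne hd with h | h
    · left; rw [hθ, sign_neg h, SignType.coe_neg_one]; ring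
    · right; rw [hθ, sign_pos h, SignType.coe_one]; ring
  have hθmem : θ ∈ Set.Ioc (-π) π := by
    rcases hθval with h | h <;> (rw [h]; constructor <;> linarith [Real.pi_pos])
  have harg : arg w = θ := by
    rw [hw, Complex.exp_mul_I]
    exact arg_mul_cos_add_sin_mul_I hr hθmem
  have hw2 : w ^ 2 = -2 * (d : ℂ) * I := by
    rw [hw, mul_pow, ← Complex.exp_nat_mul, ← Complex.ofReal_pow, Real.sq_sqrt h2d.le,
      show ((2 : ℕ) : ℂ) * ((θ : ℂ) * I) = ((2 * θ : ℝ) : ℂ) * I by push_cast; ring, Complex.exp_mul_I,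
      ← Complex.ofReal_cos, ← Complex.ofReal_sin]
    rcases lt_or_gt_of_ne hd with h | h
    · rw [hθ, sign_neg h, SignType.coe_neg_one, abs_of_neg (by linarith : 2 * d < 0),
        show 2 * -(π / 4 * (-1 : ℝ)) = π / 2 by ring, Real.cos_pi_div_two, Real.sin_pi_div_two]
      push_cast
      ring
    · rw [hθ, sign_pos h, SignType.coe_one, abs_of_pos (by linarith : 0 < 2 * d),
        show 2 * -(π / 4 * (1 : ℝ)) = -(π / 2) by ring, Real.cos_neg, Real.sin_neg, Real.cos_pi_div_two,
        Real.sin_pi_div_two]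
      push_cast
      ring
  rw [← hw2, show (1 / 2 : ℂ) = (2 : ℂ)⁻¹ by norm_num]
  refine pow_cpow_ofNat_inv ?_ ?_
  · rw [harg]; rcases hθval with h | h <;> (rw [h]; linarith [Real.pi_pos])
  · rw [harg]; rcases hθval with h | h <;> (rw [h]; linarith [Real.pi_pos])

/-- the limiting Fourier-side constant: `1 / (-2id)^{1/2} = γ · |2d|^{-1/2}`. [cite: Weil1964, Chap. II n° 26, p. 174] -/
private theorem one_div_cpow_bReg_zero {d : ℝ} (hd : d ≠ 0) :
    1 / bReg d 0 ^ (1 / 2 : ℂ) = realWeilIndex d * ((|2 * d| ^ (-(1 / 2 : ℝ)) : ℝ) : ℂ) := by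
  have h2d : 0 < |2 * d| := abs_pos.2 (mul_ne_zero two_ne_zero hd)
  rw [bReg_zero, cpow_half_neg_two_mul_I hd, realWeilIndex, Real.rpow_neg h2d.le, ← Real.sqrt_eq_rpow,
    one_div, mul_inv, ← Complex.exp_neg, mul_comm]
  congr 1
  · congr 1; push_cast; ring
  · push_cast; rfl

/-- the limiting Fourier-side kernel: `e^{-π x²/(-2id)} = e^{-2πi x²/(4d)} = f_{-1/(4d)}(x)` (Weil's
`f̄(x* ρ⁻¹)`, `ρ = 2d`). [cite: Weil1964, Chap. I n° 14 Thm 2, p. 161] -/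
private theorem cexp_div_bReg_zero {d : ℝ} (hd : d ≠ 0) (x : ℝ) :
    cexp (-π / bReg d 0 * (x : ℂ) ^ 2) = realChirp (-(1 / (4 * d))) x := by
  rw [bReg_zero, realChirp]
  congr 1
  have hne : (-2 * (d : ℂ) * I) ≠ 0 := by rw [← bReg_zero]; exact bReg_ne_zero hd 0
  have hd' : (d : ℂ) ≠ 0 := Complex.ofReal_ne_zero.2 hd
  rw [div_mul_eq_mul_div, div_eq_iff hne]
  push_cast
  field_simp
  ring_nf
  rw [Complex.I_sq]
  ring

/-- **Weil's Théorème 2 for `G = ℝ`** (the Fourier transform of the second-degree character `f = e^{2πi d ξ²}`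
as a tempered distribution): for every `g ∈ L¹(ℝ)` with `𝓕 g ∈ L¹(ℝ)`,
`∫ f(ξ) 𝓕g(ξ) dξ = γ(f) |2d|^{-1/2} ∫ e^{-2πi x²/(4d)} g(x) dx`, i.e. `𝓕(f) = γ(f) |ρ|^{-1/2} f̄(· ρ⁻¹)` with
`ρ = 2d` and `γ(f) = realWeilIndex d`. [cite: Weil1964, Chap. I n° 14 Thm 2, p. 161; value: Chap. II n° 26, p. 174] -/
theorem integral_realChirp_mul_fourier {d : ℝ} (hd : d ≠ 0) {g : ℝ → ℂ} (hg : Integrable g)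
    (hFg : Integrable (𝓕 g)) :
    ∫ ξ, realChirp d ξ * 𝓕 g ξ =
      realWeilIndex d * ((|2 * d| ^ (-(1 / 2 : ℝ)) : ℝ) : ℂ) * ∫ x, realChirp (-(1 / (4 * d))) x * g x := by
  -- (A) the identity for the regularised characters, `ε > 0`
  have hA : ∀ ε : ℝ, 0 < ε → ∫ ξ : ℝ, cexp (-π * bReg d ε * (ξ : ℂ) ^ 2) * 𝓕 g ξ =
      ∫ x : ℝ, (1 / bReg d ε ^ (1 / 2 : ℂ) * cexp (-π / bReg d ε * (x : ℂ) ^ 2)) * g x := by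
    intro ε hε
    have hre : 0 < (bReg d ε).re := by rw [bReg_re]; exact hε
    have hint : Integrable (fun ξ : ℝ => cexp (-π * bReg d ε * (ξ : ℂ) ^ 2)) := by
      have h := integrable_cexp_neg_mul_sq (b := π * bReg d ε)
        (by rw [Complex.re_ofReal_mul]; exact mul_pos Real.pi_pos hre)
      simpa only [neg_mul] using h
    have key : ∫ ξ : ℝ, 𝓕 (fun x : ℝ => cexp (-π * bReg d ε * (x : ℂ) ^ 2)) ξ * g ξ =
        ∫ x : ℝ, cexp (-π * bReg d ε * (x : ℂ) ^ 2) * 𝓕 g x := by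
      simpa using! VectorFourier.integral_fourierIntegral_smul_eq_flip (L := innerₗ ℝ)
        Real.continuous_fourierChar continuous_inner hint hg
    rw [fourier_gaussian_pi hre] at key
    exact key.symm
  -- (B1) `ε → 0⁺` on the character side
  have hB1 : Tendsto (fun ε => ∫ ξ : ℝ, cexp (-π * bReg d ε * (ξ : ℂ) ^ 2) * 𝓕 g ξ) (𝓝[>] 0)
      (𝓝 (∫ ξ, realChirp d ξ * 𝓕 g ξ)) := by
    refine tendsto_integral_filter_of_dominated_convergence (fun ξ => ‖𝓕 g ξ‖) ?_ ?_ hFg.norm ?_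
    · exact Eventually.of_forall fun ε =>
        (Continuous.aestronglyMeasurable (by
          have := continuous_bReg d
          fun_prop)).mul hFg.aestronglyMeasurable
    · filter_upwards [self_mem_nhdsWithin] with ε (hε : 0 < ε)
      exact Eventually.of_forall fun ξ => by
        rw [norm_mul]
        exact mul_le_of_le_one_left (norm_nonneg _) (norm_cexp_bReg_le d hε.le ξ)
    · refine Eventually.of_forall fun ξ => ?_
      have hc : Continuous fun ε : ℝ => cexp (-π * bReg d ε * (ξ : ℂ) ^ 2) * 𝓕 g ξ := by
        have := continuous_bReg d
        fun_prop
      have h0 : cexp (-π * bReg d 0 * (ξ : ℂ) ^ 2) * 𝓕 g ξ = realChirp d ξ * 𝓕 g ξ := by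
        rw [bReg_zero, realChirp]
        congr 2
        ring
      rw [← h0]
      exact tendsto_nhdsWithin_of_tendsto_nhds (hc.tendsto 0)
  -- (B2) `ε → 0⁺` on the Fourier side
  have hB2 : Tendsto (fun ε => ∫ x : ℝ, (1 / bReg d ε ^ (1 / 2 : ℂ) * cexp (-π / bReg d ε * (x : ℂ) ^ 2)) * g x)
      (𝓝[>] 0) (𝓝 (∫ x : ℝ, (1 / bReg d 0 ^ (1 / 2 : ℂ) * cexp (-π / bReg d 0 * (x : ℂ) ^ 2)) * g x)) := by
    refine tendsto_integral_filter_of_dominated_convergence (fun x => |2 * d| ^ (-(1 / 2 : ℝ)) * ‖g x‖)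
      ?_ ?_ (hg.norm.const_mul _) ?_
    · refine Eventually.of_forall fun ε => (Continuous.aestronglyMeasurable ?_).mul hg.aestronglyMeasurable
      exact continuous_const.mul (Complex.continuous_exp.comp (continuous_const.mul (by fun_prop)))
    · filter_upwards [self_mem_nhdsWithin] with ε (hε : 0 < ε)
      exact Eventually.of_forall fun x => by
        rw [norm_mul, norm_mul]
        calc ‖1 / bReg d ε ^ (1 / 2 : ℂ)‖ * ‖cexp (-π / bReg d ε * (x : ℂ) ^ 2)‖ * ‖g x‖
            ≤ |2 * d| ^ (-(1 / 2 : ℝ)) * 1 * ‖g x‖ := by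
              gcongr
              · exact norm_one_div_cpow_bReg_le hd ε
              · exact norm_cexp_div_bReg_le d hε.le x
          _ = |2 * d| ^ (-(1 / 2 : ℝ)) * ‖g x‖ := by rw [mul_one]
    · refine Eventually.of_forall fun x => tendsto_nhdsWithin_of_tendsto_nhds ?_
      have hslit : bReg d 0 ∈ slitPlane := by
        rw [mem_slitPlane_iff, bReg_im]
        right
        intro h
        exact hd (by linarith)
      have h1 : ContinuousAt (fun ε : ℝ => bReg d ε ^ (1 / 2 : ℂ)) 0 :=
        ContinuousAt.comp (g := fun z : ℂ => z ^ (1 / 2 : ℂ)) (continuousAt_cpow_const hslit)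
          (continuous_bReg d).continuousAt
      have h2 : ContinuousAt (fun ε : ℝ => 1 / bReg d ε ^ (1 / 2 : ℂ)) 0 :=
        continuousAt_const.div h1 (by
          rw [Ne, Complex.cpow_eq_zero_iff, not_and_or]
          exact Or.inl (bReg_ne_zero hd 0))
      have h3 : Continuous fun ε : ℝ => cexp (-π / bReg d ε * (x : ℂ) ^ 2) :=
        Complex.continuous_exp.comp
          ((continuous_const.div (continuous_bReg d) (bReg_ne_zero hd)).mul continuous_const)
      exact ((h2.mul h3.continuousAt).mul continuousAt_const).tendsto
  -- (C) the two sides agree for `ε > 0`, hence in the limit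
  have hAC : (fun ε => ∫ ξ : ℝ, cexp (-π * bReg d ε * (ξ : ℂ) ^ 2) * 𝓕 g ξ) =ᶠ[𝓝[>] 0]
      fun ε => ∫ x : ℝ, (1 / bReg d ε ^ (1 / 2 : ℂ) * cexp (-π / bReg d ε * (x : ℂ) ^ 2)) * g x := by
    filter_upwards [self_mem_nhdsWithin] with ε hε using hA ε hε
  have hlim : ∫ ξ, realChirp d ξ * 𝓕 g ξ =
      ∫ x : ℝ, (1 / bReg d 0 ^ (1 / 2 : ℂ) * cexp (-π / bReg d 0 * (x : ℂ) ^ 2)) * g x :=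
    tendsto_nhds_unique (hB1.congr' hAC) hB2
  -- (D) evaluate the limit kernel
  rw [hlim, ← integral_const_mul]
  congr 1
  funext x
  rw [one_div_cpow_bReg_zero hd, cexp_div_bReg_zero hd, mul_assoc]

/-- Théorème 2 for `G = ℝ`, Schwartz test functions. [cite: Weil1964, Chap. I n° 14 Thm 2, p. 161] -/
theorem integral_realChirp_mul_fourier_schwartz {d : ℝ} (hd : d ≠ 0) (g : 𝓢(ℝ, ℂ)) :
    ∫ ξ, realChirp d ξ * 𝓕 (⇑g) ξ =
      realWeilIndex d * ((|2 * d| ^ (-(1 / 2 : ℝ)) : ℝ) : ℂ) * ∫ x, realChirp (-(1 / (4 * d))) x * g x :=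
  integral_realChirp_mul_fourier hd g.integrable (by
    rw [← SchwartzMap.fourier_coe]
    exact (𝓕 g).integrable)

/-! ## §4 Corollaire 2 for `G = ℝ`: `∫ (Φ ∗ f) = γ(f) |ρ|^{-1/2} ∫ Φ` -/

/-- the convolution with a second-degree character is a modulated Fourier transform:
`(Φ ∗ f)(x) = ∫ Φ(u) f(x - u) du = f(x) · 𝓕(f Φ)(2 c x)`. [cite: Weil1964, Chap. I n° 14, p. 161] -/
theorem integral_mul_realChirp_sub (c : ℝ) (Φ : ℝ → ℂ) (x : ℝ) :
    ∫ u, Φ u * realChirp c (x - u) = realChirp c x * 𝓕 (fun u => realChirp c u * Φ u) (2 * c * x) := by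
  rw [Real.fourier_real_eq_integral_exp_smul, ← integral_const_mul]
  congr 1
  funext u
  rw [smul_eq_mul, realChirp_sub]
  ring

/-- **Weil's Corollaire 2 for `G = ℝ`**: for every Schwartz function `Φ` and the non-degenerate second-degree
character `f = e^{2πi c x²}` (`ρ = 2c`), `∫ (Φ ∗ f)(x) dx = γ(f) |ρ|^{-1/2} ∫ Φ(x) dx` — the formula by which
n° 26 computes `γ` ("un calcul élémentaire donne alors pour `γ(q₁)` la valeur `e^{πi/4}` si `λ > 0` et
`e^{-πi/4}` si `λ < 0`"). [cite: Weil1964, Chap. I n° 14 Cor. 2, p. 162; Chap. II n° 26, pp. 173–174] -/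
theorem weil_corollary2_real {c : ℝ} (hc : c ≠ 0) (Φ : 𝓢(ℝ, ℂ)) :
    ∫ x, ∫ u, Φ u * realChirp c (x - u) =
      realWeilIndex c * ((|2 * c| ^ (-(1 / 2 : ℝ)) : ℝ) : ℂ) * ∫ x, Φ x := by
  -- `h = f · Φ ∈ 𝓢(ℝ)` (temperate growth of `f`)
  set h : 𝓢(ℝ, ℂ) := SchwartzMap.smulLeftCLM ℂ (realChirp c) Φ with hh
  have h_apply : ∀ u, h u = realChirp c u * Φ u := fun u => by
    rw [hh, SchwartzMap.smulLeftCLM_apply_apply (hasTemperateGrowth_realChirp c), smul_eq_mul]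
  have h_coe : (fun u => realChirp c u * Φ u) = ⇑h := funext fun u => (h_apply u).symm
  have hc2 : (2 * c) ≠ 0 := mul_ne_zero two_ne_zero hc
  have hc4 : 1 / (4 * c) ≠ 0 := one_div_ne_zero (mul_ne_zero four_ne_zero hc)
  have h2c : 0 < |2 * c| := abs_pos.2 hc2
  -- the inner integrals are `f(x) 𝓕h(2cx)`; substitute `ξ = 2 c x`
  simp_rw [integral_mul_realChirp_sub, h_coe]
  have hcx : ∀ x, realChirp (1 / (4 * c)) (2 * c * x) = realChirp c x := fun x => by
    rw [show (1 / (4 * c)) = c * (1 / (2 * c)) ^ 2 by field_simp; ring, realChirp_mul_sq]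
    congr 1
    field_simp
  have hsub : ∫ x, realChirp c x * 𝓕 (⇑h) (2 * c * x) =
      ((|2 * c|⁻¹ : ℝ) : ℂ) * ∫ y, realChirp (1 / (4 * c)) y * 𝓕 (⇑h) y := by
    have := Measure.integral_comp_mul_left (fun y => realChirp (1 / (4 * c)) y * 𝓕 (⇑h) y) (2 * c)
    simp only [hcx] at this
    rw [this, abs_inv, Complex.real_smul]
  rw [hsub, integral_realChirp_mul_fourier_schwartz hc4 h]
  -- back to `Φ`: `f_{-c} · (f_c Φ) = Φ`
  have hback : ∀ x, realChirp (-(1 / (4 * (1 / (4 * c))))) x * h x = Φ x := fun x => by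
    rw [h_apply, ← mul_assoc, show -(1 / (4 * (1 / (4 * c)))) = -c by field_simp,
      mul_comm (realChirp (-c) x), realChirp_mul_realChirp_neg, one_mul]
  simp_rw [hback]
  rw [realWeilIndex_one_div_four_mul, ← mul_assoc, ← mul_assoc]
  congr 1
  -- constants: `|2c|⁻¹ · γ · |2/(4c)|^{-1/2} = γ · |2c|^{-1/2}`
  rw [mul_comm (((|2 * c|⁻¹ : ℝ) : ℂ)), mul_assoc]
  congr 1
  rw [show 2 * (1 / (4 * c)) = (2 * c)⁻¹ by field_simp; ring, abs_inv, Real.inv_rpow h2c.le,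
    Real.rpow_neg h2c.le, inv_inv]
  push_cast
  rw [← Complex.ofReal_inv, show ((|2 * c|⁻¹ : ℝ) : ℂ) = (((|2 * c| ^ (1 / 2 : ℝ)) ^ 2)⁻¹ : ℝ) by
    rw [← Real.rpow_natCast, ← Real.rpow_mul h2c.le]; norm_num]
  have hne : ((|2 * c| ^ (1 / 2 : ℝ) : ℝ) : ℂ) ≠ 0 := by
    exact_mod_cast (Real.rpow_pos_of_pos h2c _).ne'
  push_cast
  field_simp

/-- **uniqueness of Weil's scalar**: if `γ ∈ ℂ` satisfies Corollaire 2 for `f = e^{2πi c x²}` and ONE Schwartz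
function `Φ` with `∫ Φ ≠ 0` (Weil: "en prenant par exemple `Φ(x) = e^{-πx²}`"), then `γ = realWeilIndex c`;
so the definition by value IS Weil's `γ(f)`. [cite: Weil1964, Chap. I n° 14 Thm 2 and Cor. 2, pp. 161–162] -/
theorem realWeilIndex_unique {c : ℝ} (hc : c ≠ 0) {γ : ℂ} (Φ : 𝓢(ℝ, ℂ)) (hΦ : ∫ x, Φ x ≠ 0)
    (h : ∫ x, ∫ u, Φ u * realChirp c (x - u) = γ * ((|2 * c| ^ (-(1 / 2 : ℝ)) : ℝ) : ℂ) * ∫ x, Φ x) :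
    γ = realWeilIndex c := by
  rw [weil_corollary2_real hc Φ] at h
  have hne : ((|2 * c| ^ (-(1 / 2 : ℝ)) : ℝ) : ℂ) ≠ 0 := by
    exact_mod_cast (Real.rpow_pos_of_pos (abs_pos.2 (mul_ne_zero two_ne_zero hc)) _).ne'
  exact (mul_right_cancel₀ hne (mul_right_cancel₀ hΦ h)).symm

/-- the index for the TREE's standard real character `ψ_ℝ(x) = e^{-2πix}` (Tate's sign, `λ = -1`): the
second-degree character of `q(x) = a x²` is `realChirp (-a)` and its index is `conj (realWeilIndex a)
= e^{-iπ sgn(a)/4}`. [cite: Weil1964, Chap. II n° 26, p. 174] -/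
theorem realWeilIndex_tate (a : ℝ) : realWeilIndex (-1 * a) = (starRingEnd ℂ) (realWeilIndex a) := by
  rw [neg_one_mul, realWeilIndex_neg]

end Literature.NumberTheory.Weil1964
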